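import Literature.Analysis.Calculus.SmoothCutoff
import Literature.Geometry.Lorentzian.KerrCombinedCurrent
import HarnessLib

/-!
# Explicit `r*`-profiles for the multipliers `f, h, χ₁, χ₂` of the large superradiant range `𝓖^♯`
# (Dafermos–Rodnianski–Shlapentokh-Rothman, proof of Proposition 8.3.1, Stages 1–3)

(family `gr`, infrastructure for statement **gr.S24**; namespace `Literature.Geometry.Lorentzian.Kerr`)

Dafermos–Rodnianski–Shlapentokh-Rothman (*Decay for solutions of the wave equation on Kerr
exterior spacetimes III*, arXiv:1402.7034 = Ann. of Math. 183 (2016)), proof of Proposition 8.3.1,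
use a current `Q = Q^f + Ϙ^h − Eχ₁Q^K − Eχ₂Q^T` whose multipliers are described qualitatively:
(choices1) `f = −1` at `r = r₊`, `f = 0` at `r = r_max`, `f = 1` for `r* ≥ R*_∞`; (choices2)
`f' ≥ 0`; Stage 2: `h = A h̃` with `h̃ ≥ 0` a plateau bump, `h̃ = 1` on
`[r_max − δ/2, r_max + δ/2]`, supported in `[r_max − δ, r_max + δ]`; Stage 3: cut-offs `χ₁ = 1`
near `r₊`, `χ₁ = 0` for `r ≥ r_max + δ/2`, `χ₂ = 1 − χ₁`-like ("the reader may easily construct a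
function `f` satisfying the conditions …"). This file **constructs such functions once and for
all as explicit profiles of `x = r*`** centred at a point `c` (`= r*(r_max)`), with two length
scales `L` (the virial weight) and `d` (the bump and the cut-offs) and the amplitude `A`, and
proves everything about them that the multiplier estimate (`KerrLargeSuperradiantEstimate.lean`)
consumes:

* `sharpBump = Literature.Analysis.Calculus.cutoff 2` (smooth, even, `= 1` on `|t| ≤ 1`, `= 0`
  on `|t| ≥ 2`, values in `[0, 1]`), its derivatives `sharpBump₁`, `sharpBump₂` (bounded,
  vanishing on `|t| < 1` and `|t| > 2`), its primitive `sharpBumpPrim t = ∫₀ᵗ sharpBump` (`= t` on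
  `[−1, 1]`, `= ±sharpBumpMass` for `±t ≥ 2`, monotone, `|sharpBumpPrim| ≤ sharpBumpMass`,
  `1 ≤ sharpBumpMass ≤ 2`);
* `sharpMultipliers c L d A : Multipliers` with `f(x) = sharpBumpPrim((x − c)/L)/sharpBumpMass`
  — so that **`f` is linear, `f = (x − c)/(L·sharpBumpMass)`, on `|x − c| ≤ L`** (this replaces
  the conditions (choices3)–(choices5) of loc. cit.: `f''' = 0` near `c`), `f = ±1` for
  `±(x − c) ≥ 2L`, `f' = sharpBump((x − c)/L)/(L·sharpBumpMass) ≥ 0`;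
  `h(x) = A·sharpBump((x − c)/d)`; `y = 0`; `χ₂(x) = smoothTransition((x − c)/d + ½)`,
  `χ₁ = 1 − χ₂` (so `χ₁' = −χ₂'` is supported in `|x − c| ≤ d/2`, inside the plateau of `h`);
* `hasDerivs_sharpMultipliers`, the end limits `endLimits_sharpMultipliers_atTop/atBot`
  (`f → ±1`, `χ₂ → 1, 0`, `χ₁ → 0, 1`, all profiles eventually constant), and the pointwise facts
  (values, signs, supports, bounds) listed in the section headers below.

Only existential bounds on `|smoothTransition'|` and `|sharpBump''|` are used (continuity and
compact support), no closed forms.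

## References

* M. Dafermos, I. Rodnianski, Y. Shlapentokh-Rothman, arXiv:1402.7034 = Ann. of Math. 183
  (2016), §8.3, proof of Proposition 8.3.1 ((choices1)–(choices5), Stages 2–3)
  (key `DafermosRodnianskiShlapentokhrothman2014`).
-/

noncomputable section

open Set Filter Topology MeasureTheory
open scoped ContDiff

namespace Literature.Geometry.Lorentzian

namespace Kerr

open Literature.Analysis.Calculus

/-! ### The plateau bump `φ = cutoff 2` and its first two derivatives -/

/-- The plateau bump `φ(t) = cutoff 2 t = S(t + 2)S(2 − t)` (`S` = `Real.smoothTransition`):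
smooth, `= 1` on `|t| ≤ 1`, `= 0` on `|t| ≥ 2`, values in `[0, 1]`. The profile `h̃` of Stage 2
of the proof of DRSR arXiv:1402.7034, Prop. 8.3.1, read in `r*`. [folklore] -/
def sharpBump (t : ℝ) : ℝ := cutoff 2 t

/-- `φ' = deriv φ`. [folklore] -/
def sharpBump₁ (t : ℝ) : ℝ := deriv sharpBump t

/-- `φ'' = deriv φ'`. [folklore] -/
def sharpBump₂ (t : ℝ) : ℝ := deriv sharpBump₁ t

/-- `φ = cutoff 2` as functions. [folklore] -/
theorem sharpBump_eq : sharpBump = cutoff 2 := rfl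

/-- `φ` is smooth. [folklore] -/
theorem contDiff_sharpBump : ContDiff ℝ ∞ sharpBump := by
  rw [sharpBump_eq]; exact contDiff_cutoff 2

/-- `φ'` is smooth. [folklore] -/
theorem contDiff_sharpBump₁ : ContDiff ℝ ∞ sharpBump₁ := by
  have h := (contDiff_infty_iff_deriv.1 contDiff_sharpBump).2
  exact h

/-- `φ` is continuous. [folklore] -/
theorem continuous_sharpBump : Continuous sharpBump := contDiff_sharpBump.continuous

/-- `φ'` is continuous. [folklore] -/
theorem continuous_sharpBump₁ : Continuous sharpBump₁ := contDiff_sharpBump₁.continuous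

/-- `φ''` is continuous. [folklore] -/
theorem continuous_sharpBump₂ : Continuous sharpBump₂ := by
  have h := contDiff_sharpBump₁.continuous_deriv (by simp)
  exact h

/-- `φ' ` is the derivative of `φ`. [folklore] -/
theorem hasDerivAt_sharpBump (t : ℝ) : HasDerivAt sharpBump (sharpBump₁ t) t :=
  ((contDiff_sharpBump.differentiable (by simp)) t).hasDerivAt

/-- `φ''` is the derivative of `φ'`. [folklore] -/
theorem hasDerivAt_sharpBump₁ (t : ℝ) : HasDerivAt sharpBump₁ (sharpBump₂ t) t :=
  ((contDiff_sharpBump₁.differentiable (by simp)) t).hasDerivAt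

/-- `0 ≤ φ`. [folklore] -/
theorem sharpBump_nonneg (t : ℝ) : 0 ≤ sharpBump t := cutoff_nonneg 2 t

/-- `φ ≤ 1`. [folklore] -/
theorem sharpBump_le_one (t : ℝ) : sharpBump t ≤ 1 := cutoff_le_one 2 t

/-- `φ = 1` on `|t| ≤ 1`. [folklore] -/
theorem sharpBump_eq_one {t : ℝ} (h : |t| ≤ 1) : sharpBump t = 1 :=
  cutoff_eq_one (by norm_num; exact h)

/-- `φ = 0` on `|t| ≥ 2`. [folklore] -/
theorem sharpBump_eq_zero {t : ℝ} (h : 2 ≤ |t|) : sharpBump t = 0 := cutoff_eq_zero h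

/-- `φ` is even. [folklore] -/
theorem sharpBump_neg (t : ℝ) : sharpBump (-t) = sharpBump t := by
  simp only [sharpBump, cutoff]
  rw [mul_comm]
  congr 1 <;> ring_nf

/-- `φ' = 0` on `|t| ≥ 2`. [folklore] -/
theorem sharpBump₁_eq_zero_of_le {t : ℝ} (h : 2 ≤ |t|) : sharpBump₁ t = 0 :=
  deriv_cutoff_eq_zero_of_le h

/-- `φ' = 0` on the open plateau `|t| < 1`. [folklore] -/
theorem sharpBump₁_eq_zero_of_lt {t : ℝ} (h : |t| < 1) : sharpBump₁ t = 0 :=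
  deriv_cutoff_eq_zero_of_lt (by norm_num; exact h)

/-- `φ'' = 0` for `|t| > 2` (`φ'` vanishes identically near `t`). [folklore] -/
theorem sharpBump₂_eq_zero_of_lt {t : ℝ} (h : 2 < |t|) : sharpBump₂ t = 0 := by
  have heq : sharpBump₁ =ᶠ[𝓝 t] fun _ ↦ (0 : ℝ) := by
    have ho : IsOpen {s : ℝ | 2 < |s|} := isOpen_lt continuous_const continuous_abs
    filter_upwards [ho.mem_nhds h] with s hs
    exact sharpBump₁_eq_zero_of_le (le_of_lt hs)
  show deriv sharpBump₁ t = 0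
  rw [heq.deriv_eq, deriv_const]

/-- `φ'' = 0` on the open plateau `|t| < 1`. [folklore] -/
theorem sharpBump₂_eq_zero_of_abs_lt_one {t : ℝ} (h : |t| < 1) : sharpBump₂ t = 0 := by
  have heq : sharpBump₁ =ᶠ[𝓝 t] fun _ ↦ (0 : ℝ) := by
    have ho : IsOpen {s : ℝ | |s| < 1} := isOpen_lt continuous_abs continuous_const
    filter_upwards [ho.mem_nhds h] with s hs
    exact sharpBump₁_eq_zero_of_lt hs
  show deriv sharpBump₁ t = 0
  rw [heq.deriv_eq, deriv_const]

/-- **`φ''` is bounded**: `|φ''| ≤ D₂` (continuous, and zero off `[−2, 2]`). [folklore] -/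
theorem exists_bound_sharpBump₂ : ∃ D : ℝ, 0 ≤ D ∧ ∀ t, |sharpBump₂ t| ≤ D := by
  obtain ⟨C, hC⟩ := isCompact_Icc.exists_bound_of_continuousOn
    (continuous_sharpBump₂.continuousOn (s := Icc (-2) 2))
  refine ⟨max C 0, le_max_right _ _, fun t ↦ ?_⟩
  rcases le_or_gt |t| 2 with h | h
  · exact ((Real.norm_eq_abs _).symm.le.trans (hC t (abs_le.1 h))).trans (le_max_left _ _)
  · rw [sharpBump₂_eq_zero_of_lt h, abs_zero]
    exact le_max_right _ _

/-- `φ'` is bounded. [folklore] -/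
theorem exists_bound_sharpBump₁ : ∃ D : ℝ, 0 ≤ D ∧ ∀ t, |sharpBump₁ t| ≤ D := by
  obtain ⟨D, hD0, hD⟩ := exists_bound_deriv_cutoff
  exact ⟨D, hD0, fun t ↦ hD 2 t⟩

/-! ### The primitive `Φ(t) = ∫₀ᵗ φ` and its total mass -/

/-- `Φ(t) = ∫₀ᵗ φ(s) ds`: the clipped-linear profile of the virial weight `f` (up to
normalisation). [folklore] -/
def sharpBumpPrim (t : ℝ) : ℝ := ∫ s in (0 : ℝ)..t, sharpBump s

/-- `I = Φ(2) = ∫₀² φ`, the normalisation of `f`. [folklore] -/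
def sharpBumpMass : ℝ := ∫ s in (0 : ℝ)..2, sharpBump s

/-- `Φ' = φ`. [folklore] -/
theorem hasDerivAt_sharpBumpPrim (t : ℝ) : HasDerivAt sharpBumpPrim (sharpBump t) t :=
  (continuous_sharpBump.integral_hasStrictDerivAt 0 t).hasDerivAt

/-- `Φ` is continuous. [folklore] -/
theorem continuous_sharpBumpPrim : Continuous sharpBumpPrim :=
  continuous_iff_continuousAt.2 fun t ↦ (hasDerivAt_sharpBumpPrim t).continuousAt

/-- `Φ` is monotone (`Φ' = φ ≥ 0`). [folklore] -/
theorem monotone_sharpBumpPrim : Monotone sharpBumpPrim := by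
  refine monotone_of_deriv_nonneg (fun t ↦ (hasDerivAt_sharpBumpPrim t).differentiableAt) fun t ↦ ?_
  rw [(hasDerivAt_sharpBumpPrim t).deriv]
  exact sharpBump_nonneg t

/-- `Φ(0) = 0`. [folklore] -/
theorem sharpBumpPrim_zero : sharpBumpPrim 0 = 0 := by simp [sharpBumpPrim]

/-- `Φ(t) = t` on `[−1, 1]`. [folklore] -/
theorem sharpBumpPrim_eq_self {t : ℝ} (h : |t| ≤ 1) : sharpBumpPrim t = t := by
  have heq : ∫ s in (0 : ℝ)..t, sharpBump s = ∫ s in (0 : ℝ)..t, (1 : ℝ) := by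
    refine intervalIntegral.integral_congr fun s hs ↦ ?_
    apply sharpBump_eq_one
    rcases abs_le.1 h with ⟨h1, h2⟩
    rcases le_total 0 t with ht | ht
    · rw [uIcc_of_le ht] at hs
      rw [abs_le]; exact ⟨by linarith [hs.1], hs.2.trans h2⟩
    · rw [uIcc_of_ge ht] at hs
      rw [abs_le]; exact ⟨h1.trans hs.1, by linarith [hs.2]⟩
  rw [sharpBumpPrim, heq, intervalIntegral.integral_const, smul_eq_mul, mul_one, sub_zero]

/-- `Φ(2) = I`. [folklore] -/
theorem sharpBumpPrim_two : sharpBumpPrim 2 = sharpBumpMass := rfl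

/-- `Φ(t) = I` for `t ≥ 2`. [folklore] -/
theorem sharpBumpPrim_eq_mass {t : ℝ} (h : 2 ≤ t) : sharpBumpPrim t = sharpBumpMass := by
  have hi : ∀ a b : ℝ, IntervalIntegrable sharpBump volume a b := fun a b ↦
    continuous_sharpBump.intervalIntegrable a b
  have h0 : ∫ s in (2 : ℝ)..t, sharpBump s = 0 := by
    rw [← intervalIntegral.integral_zero (a := (2 : ℝ)) (b := t)]
    refine intervalIntegral.integral_congr fun s hs ↦ ?_
    rw [uIcc_of_le h] at hs
    exact sharpBump_eq_zero (by rw [abs_of_nonneg (by linarith [hs.1])]; exact hs.1)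
  rw [sharpBumpPrim, ← intervalIntegral.integral_add_adjacent_intervals (hi 0 2) (hi 2 t), h0,
    add_zero]
  rfl

/-- `Φ(t) = −I` for `t ≤ −2` (`φ` is even). [folklore] -/
theorem sharpBumpPrim_eq_neg_mass {t : ℝ} (h : t ≤ -2) : sharpBumpPrim t = -sharpBumpMass := by
  have hi : ∀ a b : ℝ, IntervalIntegrable sharpBump volume a b := fun a b ↦
    continuous_sharpBump.intervalIntegrable a b
  have h0 : ∫ s in t..(-2 : ℝ), sharpBump s = 0 := by
    rw [← intervalIntegral.integral_zero (a := t) (b := (-2 : ℝ))]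
    refine intervalIntegral.integral_congr fun s hs ↦ ?_
    rw [uIcc_of_le h] at hs
    exact sharpBump_eq_zero (by rw [abs_of_nonpos (by linarith [hs.2])]; linarith [hs.2])
  have h1 : ∫ s in (-2 : ℝ)..0, sharpBump s = sharpBumpMass := by
    have h2 : ∫ s in (0 : ℝ)..2, sharpBump (-s) = ∫ s in (-2 : ℝ)..(-0), sharpBump s :=
      intervalIntegral.integral_comp_neg sharpBump
    rw [neg_zero] at h2
    rw [← h2]
    simp only [sharpBump_neg]
    rfl
  rw [sharpBumpPrim, intervalIntegral.integral_symm, ←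
    intervalIntegral.integral_add_adjacent_intervals (hi t (-2)) (hi (-2) 0), h0, zero_add, h1]

/-- `1 ≤ I ≤ 2` (`φ = 1` on `[0, 1]`, `0 ≤ φ ≤ 1` on `[1, 2]`). [folklore] -/
theorem sharpBumpMass_mem_Icc : sharpBumpMass ∈ Icc (1 : ℝ) 2 := by
  have hi : ∀ a b : ℝ, IntervalIntegrable sharpBump volume a b := fun a b ↦
    continuous_sharpBump.intervalIntegrable a b
  have h1 : ∫ s in (0 : ℝ)..1, sharpBump s = 1 := by
    have := sharpBumpPrim_eq_self (t := 1) (by norm_num)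
    simpa [sharpBumpPrim] using this
  have h2 : 0 ≤ ∫ s in (1 : ℝ)..2, sharpBump s :=
    intervalIntegral.integral_nonneg (by norm_num) fun s _ ↦ sharpBump_nonneg s
  have h3 : ∫ s in (1 : ℝ)..2, sharpBump s ≤ 1 := by
    have h := intervalIntegral.integral_mono_on (by norm_num : (1 : ℝ) ≤ 2) (hi 1 2)
      (intervalIntegrable_const (c := (1 : ℝ))) fun s _ ↦ sharpBump_le_one s
    rw [intervalIntegral.integral_const, smul_eq_mul, mul_one] at h
    linarith
  have hsplit : sharpBumpMass =
      (∫ s in (0 : ℝ)..1, sharpBump s) + ∫ s in (1 : ℝ)..2, sharpBump s := by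
    rw [sharpBumpMass, intervalIntegral.integral_add_adjacent_intervals (hi 0 1) (hi 1 2)]
  rw [hsplit, h1]
  exact ⟨by linarith, by linarith⟩

/-- `0 < I`. [folklore] -/
theorem sharpBumpMass_pos : 0 < sharpBumpMass := lt_of_lt_of_le one_pos sharpBumpMass_mem_Icc.1

/-- `|Φ| ≤ I`. [folklore] -/
theorem abs_sharpBumpPrim_le (t : ℝ) : |sharpBumpPrim t| ≤ sharpBumpMass := by
  rw [abs_le]
  constructor
  · rcases le_total t (-2) with h | h
    · rw [sharpBumpPrim_eq_neg_mass h]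
    · have := monotone_sharpBumpPrim h
      rwa [sharpBumpPrim_eq_neg_mass le_rfl] at this
  · rcases le_total 2 t with h | h
    · rw [sharpBumpPrim_eq_mass h]
    · have := monotone_sharpBumpPrim h
      rwa [sharpBumpPrim_eq_mass le_rfl] at this

/-- `Φ ≥ 0` on `t ≥ 0`. [folklore] -/
theorem sharpBumpPrim_nonneg {t : ℝ} (h : 0 ≤ t) : 0 ≤ sharpBumpPrim t := by
  have := monotone_sharpBumpPrim h; rwa [sharpBumpPrim_zero] at this

/-- `Φ ≤ 0` on `t ≤ 0`. [folklore] -/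
theorem sharpBumpPrim_nonpos {t : ℝ} (h : t ≤ 0) : sharpBumpPrim t ≤ 0 := by
  have := monotone_sharpBumpPrim h; rwa [sharpBumpPrim_zero] at this

/-- `Φ ≥ 1` on `t ≥ 1`. [folklore] -/
theorem one_le_sharpBumpPrim {t : ℝ} (h : 1 ≤ t) : 1 ≤ sharpBumpPrim t := by
  have := monotone_sharpBumpPrim h; rwa [sharpBumpPrim_eq_self (t := 1) (by norm_num)] at this

/-- `Φ ≤ −1` on `t ≤ −1`. [folklore] -/
theorem sharpBumpPrim_le_neg_one {t : ℝ} (h : t ≤ -1) : sharpBumpPrim t ≤ -1 := by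
  have := monotone_sharpBumpPrim h; rwa [sharpBumpPrim_eq_self (t := -1) (by norm_num)] at this

/-! ### The multipliers of the `𝓖^♯` current as `r*`-profiles -/

/-- **The multipliers `f, h, y = 0, χ₁, χ₂` of the current `Q = Q^f + Ϙ^h − Eχ₁Q^K − Eχ₂Q^T` of
DRSR arXiv:1402.7034, proof of Prop. 8.3.1, as explicit functions of `x = r*`**, centred at `c`
(the `r*`-value of `r_max`), with the length scales `L` (virial weight) and `d` (bump and
cut-offs) and the amplitude `A` of `h = A h̃`:
`f(x) = Φ((x − c)/L)/I`, `h(x) = A φ((x − c)/d)`, `χ₂(x) = S((x − c)/d + ½)`, `χ₁ = 1 − χ₂`,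
together with their `r*`-derivatives (`Φ = sharpBumpPrim`, `φ = sharpBump`, `I = sharpBumpMass`,
`S = Real.smoothTransition`). See the module docstring for the correspondence with
(choices1)–(choices5) and Stages 2–3 of loc. cit.
[cite: DafermosRodnianskiShlapentokhrothman2014, Prop. 8.3.1 (proof)] -/
def sharpMultipliers (c L d A : ℝ) : Multipliers where
  f x := sharpBumpPrim ((x - c) / L) / sharpBumpMass
  f' x := sharpBump ((x - c) / L) / (L * sharpBumpMass)
  f'' x := sharpBump₁ ((x - c) / L) / (L ^ 2 * sharpBumpMass)
  f''' x := sharpBump₂ ((x - c) / L) / (L ^ 3 * sharpBumpMass)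
  h x := A * sharpBump ((x - c) / d)
  h' x := A * sharpBump₁ ((x - c) / d) / d
  h'' x := A * sharpBump₂ ((x - c) / d) / d ^ 2
  y := 0
  y' := 0
  χ₁ x := 1 - Real.smoothTransition ((x - c) / d + 1 / 2)
  χ₁' x := -(deriv Real.smoothTransition ((x - c) / d + 1 / 2) / d)
  χ₂ x := Real.smoothTransition ((x - c) / d + 1 / 2)
  χ₂' x := deriv Real.smoothTransition ((x - c) / d + 1 / 2) / d

section Profiles

variable {c L d A D x : ℝ}

/-- The affine reparametrisation `x ↦ (x − c)/ℓ` has derivative `1/ℓ`. [folklore] -/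
theorem hasDerivAt_sub_div (c ℓ x : ℝ) : HasDerivAt (fun x : ℝ ↦ (x - c) / ℓ) (1 / ℓ) x := by
  simpa using ((hasDerivAt_id x).sub_const c).div_const ℓ

/-- `|(x − c)/ℓ| = |x − c|/ℓ` for `ℓ > 0`. [folklore] -/
theorem abs_sub_div {ℓ : ℝ} (hℓ : 0 < ℓ) (c x : ℝ) : |(x - c) / ℓ| = |x - c| / ℓ := by
  rw [abs_div, abs_of_pos hℓ]

/-- **The derivative relations** of `sharpMultipliers` hold everywhere (for all parameters).
[cite: DafermosRodnianskiShlapentokhrothman2014, Prop. 8.3.1 (proof)] -/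
theorem hasDerivs_sharpMultipliers (c L d A : ℝ) : (sharpMultipliers c L d A).HasDerivs where
  df x := by
    have h :=
      ((hasDerivAt_sharpBumpPrim _).comp x (hasDerivAt_sub_div c L x)).div_const sharpBumpMass
    exact h.congr_deriv (by show _ = sharpBump ((x - c) / L) / (L * sharpBumpMass); ring)
  df' x := by
    have h :=
      ((hasDerivAt_sharpBump _).comp x (hasDerivAt_sub_div c L x)).div_const (L * sharpBumpMass)
    exact h.congr_deriv (by show _ = sharpBump₁ ((x - c) / L) / (L ^ 2 * sharpBumpMass); ring)
  df'' x := by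
    have h := ((hasDerivAt_sharpBump₁ _).comp x (hasDerivAt_sub_div c L x)).div_const
      (L ^ 2 * sharpBumpMass)
    exact h.congr_deriv (by show _ = sharpBump₂ ((x - c) / L) / (L ^ 3 * sharpBumpMass); ring)
  dh x := by
    have h := ((hasDerivAt_sharpBump _).comp x (hasDerivAt_sub_div c d x)).const_mul A
    exact h.congr_deriv (by show _ = A * sharpBump₁ ((x - c) / d) / d; ring)
  dh' x := by
    have h :=
      (((hasDerivAt_sharpBump₁ _).comp x (hasDerivAt_sub_div c d x)).const_mul A).div_const d
    exact h.congr_deriv (by show _ = A * sharpBump₂ ((x - c) / d) / d ^ 2; ring)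
  dy x := hasDerivAt_const x (0 : ℝ)
  dχ₁ x := by
    have h := (hasDerivAt_const x (1 : ℝ)).sub
      ((differentiable_smoothTransition _).hasDerivAt.comp x
        ((hasDerivAt_sub_div c d x).add_const (1 / 2)))
    exact h.congr_deriv (by
      show _ = -(deriv Real.smoothTransition ((x - c) / d + 1 / 2) / d); ring)
  dχ₂ x := by
    have h := (differentiable_smoothTransition _).hasDerivAt.comp x
      ((hasDerivAt_sub_div c d x).add_const (1 / 2))
    exact h.congr_deriv (by show _ = deriv Real.smoothTransition ((x - c) / d + 1 / 2) / d; ring)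

/-! #### Values of the virial weight `f` -/

/-- `f = (x − c)/(L·I)` on the linear zone `|x − c| ≤ L`. [folklore] -/
theorem sharpMultipliers_f_eq_div (hL : 0 < L) (h : |x - c| ≤ L) :
    (sharpMultipliers c L d A).f x = (x - c) / (L * sharpBumpMass) := by
  show sharpBumpPrim ((x - c) / L) / sharpBumpMass = _
  rw [sharpBumpPrim_eq_self (by rwa [abs_sub_div hL, div_le_one hL]), div_div]

/-- `f = 1` for `x ≥ c + 2L`. [folklore] -/
theorem sharpMultipliers_f_eq_one (hL : 0 < L) (h : c + 2 * L ≤ x) :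
    (sharpMultipliers c L d A).f x = 1 := by
  show sharpBumpPrim ((x - c) / L) / sharpBumpMass = 1
  rw [sharpBumpPrim_eq_mass (by rw [le_div_iff₀ hL]; linarith), div_self sharpBumpMass_pos.ne']

/-- `f = −1` for `x ≤ c − 2L`. [folklore] -/
theorem sharpMultipliers_f_eq_neg_one (hL : 0 < L) (h : x ≤ c - 2 * L) :
    (sharpMultipliers c L d A).f x = -1 := by
  show sharpBumpPrim ((x - c) / L) / sharpBumpMass = -1
  rw [sharpBumpPrim_eq_neg_mass (by rw [div_le_iff₀ hL]; linarith), neg_div,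
    div_self sharpBumpMass_pos.ne']

/-- `f ≥ 0` for `x ≥ c`. [folklore] -/
theorem sharpMultipliers_f_nonneg (hL : 0 < L) (h : c ≤ x) :
    0 ≤ (sharpMultipliers c L d A).f x :=
  div_nonneg (sharpBumpPrim_nonneg (div_nonneg (sub_nonneg.2 h) hL.le)) sharpBumpMass_pos.le

/-- `f ≤ 0` for `x ≤ c`. [folklore] -/
theorem sharpMultipliers_f_nonpos (hL : 0 < L) (h : x ≤ c) :
    (sharpMultipliers c L d A).f x ≤ 0 :=
  div_nonpos_of_nonpos_of_nonneg (sharpBumpPrim_nonpos (div_nonpos_of_nonpos_of_nonneg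
    (sub_nonpos.2 h) hL.le)) sharpBumpMass_pos.le

/-- `f ≥ 1/I` for `x ≥ c + L`. [folklore] -/
theorem sharpMultipliers_inv_le_f (hL : 0 < L) (h : c + L ≤ x) :
    1 / sharpBumpMass ≤ (sharpMultipliers c L d A).f x := by
  show 1 / sharpBumpMass ≤ sharpBumpPrim ((x - c) / L) / sharpBumpMass
  exact div_le_div_of_nonneg_right (one_le_sharpBumpPrim (by rw [le_div_iff₀ hL]; linarith))
    sharpBumpMass_pos.le

/-- `f ≤ −1/I` for `x ≤ c − L`. [folklore] -/
theorem sharpMultipliers_f_le_neg_inv (hL : 0 < L) (h : x ≤ c - L) :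
    (sharpMultipliers c L d A).f x ≤ -(1 / sharpBumpMass) := by
  show sharpBumpPrim ((x - c) / L) / sharpBumpMass ≤ -(1 / sharpBumpMass)
  rw [← neg_div]
  exact div_le_div_of_nonneg_right (sharpBumpPrim_le_neg_one (by rw [div_le_iff₀ hL]; linarith))
    sharpBumpMass_pos.le

/-- `|f| ≤ 1`. [folklore] -/
theorem sharpMultipliers_abs_f_le_one (c L d A x : ℝ) :
    |(sharpMultipliers c L d A).f x| ≤ 1 := by
  show |sharpBumpPrim ((x - c) / L) / sharpBumpMass| ≤ 1
  rw [abs_div, abs_of_pos sharpBumpMass_pos, div_le_one sharpBumpMass_pos]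
  exact abs_sharpBumpPrim_le _

/-! #### Values of `f'`, `f''`, `f'''` -/

/-- `f' ≥ 0`. [folklore] -/
theorem sharpMultipliers_f'_nonneg (hL : 0 < L) (x : ℝ) :
    0 ≤ (sharpMultipliers c L d A).f' x :=
  div_nonneg (sharpBump_nonneg _) (mul_pos hL sharpBumpMass_pos).le

/-- `f' ≤ 1/(L·I)`. [folklore] -/
theorem sharpMultipliers_f'_le (hL : 0 < L) (x : ℝ) :
    (sharpMultipliers c L d A).f' x ≤ 1 / (L * sharpBumpMass) :=
  div_le_div_of_nonneg_right (sharpBump_le_one _) (mul_pos hL sharpBumpMass_pos).le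

/-- `f' = 1/(L·I)` on the linear zone `|x − c| ≤ L`. [folklore] -/
theorem sharpMultipliers_f'_eq (hL : 0 < L) (h : |x - c| ≤ L) :
    (sharpMultipliers c L d A).f' x = 1 / (L * sharpBumpMass) := by
  show sharpBump ((x - c) / L) / (L * sharpBumpMass) = _
  rw [sharpBump_eq_one (by rwa [abs_sub_div hL, div_le_one hL])]

/-- `f' = 0` for `|x − c| ≥ 2L`. [folklore] -/
theorem sharpMultipliers_f'_eq_zero (hL : 0 < L) (h : 2 * L ≤ |x - c|) :
    (sharpMultipliers c L d A).f' x = 0 := by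
  show sharpBump ((x - c) / L) / (L * sharpBumpMass) = 0
  rw [sharpBump_eq_zero (by rwa [abs_sub_div hL, le_div_iff₀ hL]), zero_div]

/-- `f'' = 0` for `|x − c| ≥ 2L`. [folklore] -/
theorem sharpMultipliers_f''_eq_zero (hL : 0 < L) (h : 2 * L ≤ |x - c|) :
    (sharpMultipliers c L d A).f'' x = 0 := by
  show sharpBump₁ ((x - c) / L) / (L ^ 2 * sharpBumpMass) = 0
  rw [sharpBump₁_eq_zero_of_le (by rwa [abs_sub_div hL, le_div_iff₀ hL]), zero_div]

/-- `f''' = 0` on the open linear zone `|x − c| < L`. [folklore] -/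
theorem sharpMultipliers_f'''_eq_zero_of_lt (hL : 0 < L) (h : |x - c| < L) :
    (sharpMultipliers c L d A).f''' x = 0 := by
  show sharpBump₂ ((x - c) / L) / (L ^ 3 * sharpBumpMass) = 0
  rw [sharpBump₂_eq_zero_of_abs_lt_one (by rwa [abs_sub_div hL, div_lt_one hL]), zero_div]

/-- `f''' = 0` for `|x − c| > 2L`. [folklore] -/
theorem sharpMultipliers_f'''_eq_zero_of_gt (hL : 0 < L) (h : 2 * L < |x - c|) :
    (sharpMultipliers c L d A).f''' x = 0 := by
  show sharpBump₂ ((x - c) / L) / (L ^ 3 * sharpBumpMass) = 0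
  rw [sharpBump₂_eq_zero_of_lt (by rwa [abs_sub_div hL, lt_div_iff₀ hL]), zero_div]

/-- `|f'''| ≤ D₂/(L³·I)` for a bound `D₂` of `|φ''|`. [folklore] -/
theorem sharpMultipliers_abs_f'''_le (hL : 0 < L) (hD : ∀ t, |sharpBump₂ t| ≤ D) (x : ℝ) :
    |(sharpMultipliers c L d A).f''' x| ≤ D / (L ^ 3 * sharpBumpMass) := by
  show |sharpBump₂ ((x - c) / L) / (L ^ 3 * sharpBumpMass)| ≤ _
  have hpos : 0 < L ^ 3 * sharpBumpMass := mul_pos (pow_pos hL 3) sharpBumpMass_pos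
  rw [abs_div, abs_of_pos hpos]
  exact div_le_div_of_nonneg_right (hD _) hpos.le

/-! #### Values of `h`, `h'`, `h''` -/

/-- `h = A` on the plateau `|x − c| ≤ d`. [folklore] -/
theorem sharpMultipliers_h_eq (hd : 0 < d) (h : |x - c| ≤ d) :
    (sharpMultipliers c L d A).h x = A := by
  show A * sharpBump ((x - c) / d) = A
  rw [sharpBump_eq_one (by rwa [abs_sub_div hd, div_le_one hd]), mul_one]

/-- `h = 0` for `|x − c| ≥ 2d`. [folklore] -/
theorem sharpMultipliers_h_eq_zero (hd : 0 < d) (h : 2 * d ≤ |x - c|) :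
    (sharpMultipliers c L d A).h x = 0 := by
  show A * sharpBump ((x - c) / d) = 0
  rw [sharpBump_eq_zero (by rwa [abs_sub_div hd, le_div_iff₀ hd]), mul_zero]

/-- `0 ≤ h` (`A ≥ 0`). [folklore] -/
theorem sharpMultipliers_h_nonneg (hA : 0 ≤ A) (x : ℝ) : 0 ≤ (sharpMultipliers c L d A).h x :=
  mul_nonneg hA (sharpBump_nonneg _)

/-- `h ≤ A` (`A ≥ 0`). [folklore] -/
theorem sharpMultipliers_h_le (hA : 0 ≤ A) (x : ℝ) : (sharpMultipliers c L d A).h x ≤ A :=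
  (mul_le_of_le_one_right hA (sharpBump_le_one _))

/-- `h' = 0` for `|x − c| ≥ 2d`. [folklore] -/
theorem sharpMultipliers_h'_eq_zero (hd : 0 < d) (h : 2 * d ≤ |x - c|) :
    (sharpMultipliers c L d A).h' x = 0 := by
  show A * sharpBump₁ ((x - c) / d) / d = 0
  rw [sharpBump₁_eq_zero_of_le (by rwa [abs_sub_div hd, le_div_iff₀ hd]), mul_zero, zero_div]

/-- `h'' = 0` on the open plateau `|x − c| < d`. [folklore] -/
theorem sharpMultipliers_h''_eq_zero_of_lt (hd : 0 < d) (h : |x - c| < d) :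
    (sharpMultipliers c L d A).h'' x = 0 := by
  show A * sharpBump₂ ((x - c) / d) / d ^ 2 = 0
  rw [sharpBump₂_eq_zero_of_abs_lt_one (by rwa [abs_sub_div hd, div_lt_one hd]), mul_zero, zero_div]

/-- `h'' = 0` for `|x − c| > 2d`. [folklore] -/
theorem sharpMultipliers_h''_eq_zero_of_gt (hd : 0 < d) (h : 2 * d < |x - c|) :
    (sharpMultipliers c L d A).h'' x = 0 := by
  show A * sharpBump₂ ((x - c) / d) / d ^ 2 = 0
  rw [sharpBump₂_eq_zero_of_lt (by rwa [abs_sub_div hd, lt_div_iff₀ hd]), mul_zero, zero_div]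

/-- `|h''| ≤ A·D₂/d²` (`A ≥ 0`, `D₂` a bound of `|φ''|`). [folklore] -/
theorem sharpMultipliers_abs_h''_le (hd : 0 < d) (hA : 0 ≤ A) (hD : ∀ t, |sharpBump₂ t| ≤ D)
    (x : ℝ) : |(sharpMultipliers c L d A).h'' x| ≤ A * D / d ^ 2 := by
  show |A * sharpBump₂ ((x - c) / d) / d ^ 2| ≤ _
  have hpos : 0 < d ^ 2 := pow_pos hd 2
  rw [abs_div, abs_of_pos hpos, abs_mul, abs_of_nonneg hA]
  exact div_le_div_of_nonneg_right (mul_le_mul_of_nonneg_left (hD _) hA) hpos.le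

/-! #### Values of the cut-offs `χ₁`, `χ₂` -/

/-- `0 ≤ χ₂ ≤ 1`. [folklore] -/
theorem sharpMultipliers_χ₂_mem_Icc (c L d A x : ℝ) :
    (sharpMultipliers c L d A).χ₂ x ∈ Icc (0 : ℝ) 1 :=
  ⟨Real.smoothTransition.nonneg _, Real.smoothTransition.le_one _⟩

/-- `0 ≤ χ₁ ≤ 1`. [folklore] -/
theorem sharpMultipliers_χ₁_mem_Icc (c L d A x : ℝ) :
    (sharpMultipliers c L d A).χ₁ x ∈ Icc (0 : ℝ) 1 := by
  show 1 - Real.smoothTransition ((x - c) / d + 1 / 2) ∈ Icc (0 : ℝ) 1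
  constructor
  · linarith [Real.smoothTransition.le_one ((x - c) / d + 1 / 2)]
  · linarith [Real.smoothTransition.nonneg ((x - c) / d + 1 / 2)]

/-- `χ₁ + χ₂ = 1`. [folklore] -/
theorem sharpMultipliers_χ₁_add_χ₂ (c L d A x : ℝ) :
    (sharpMultipliers c L d A).χ₁ x + (sharpMultipliers c L d A).χ₂ x = 1 := by
  show 1 - Real.smoothTransition ((x - c) / d + 1 / 2) +
    Real.smoothTransition ((x - c) / d + 1 / 2) = 1
  ring

/-- `χ₁' = −χ₂'`. [folklore] -/
theorem sharpMultipliers_χ₁'_eq_neg (c L d A x : ℝ) :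
    (sharpMultipliers c L d A).χ₁' x = -(sharpMultipliers c L d A).χ₂' x := rfl

/-- `χ₂ = 1` for `x ≥ c + d/2`. [folklore] -/
theorem sharpMultipliers_χ₂_eq_one (hd : 0 < d) (h : c + d / 2 ≤ x) :
    (sharpMultipliers c L d A).χ₂ x = 1 := by
  show Real.smoothTransition ((x - c) / d + 1 / 2) = 1
  apply Real.smoothTransition.one_of_one_le
  have : 1 / 2 ≤ (x - c) / d := by rw [le_div_iff₀ hd]; linarith
  linarith

/-- `χ₂ = 0` for `x ≤ c − d/2`. [folklore] -/
theorem sharpMultipliers_χ₂_eq_zero (hd : 0 < d) (h : x ≤ c - d / 2) :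
    (sharpMultipliers c L d A).χ₂ x = 0 := by
  show Real.smoothTransition ((x - c) / d + 1 / 2) = 0
  apply Real.smoothTransition.zero_of_nonpos
  have : (x - c) / d ≤ -(1 / 2) := by rw [div_le_iff₀ hd]; linarith
  linarith

/-- `χ₁ = 0` for `x ≥ c + d/2`. [folklore] -/
theorem sharpMultipliers_χ₁_eq_zero (hd : 0 < d) (h : c + d / 2 ≤ x) :
    (sharpMultipliers c L d A).χ₁ x = 0 := by
  show 1 - Real.smoothTransition ((x - c) / d + 1 / 2) = 0
  have h1 := sharpMultipliers_χ₂_eq_one (c := c) (L := L) (A := A) hd h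
  change Real.smoothTransition ((x - c) / d + 1 / 2) = 1 at h1
  rw [h1, sub_self]

/-- `χ₁ = 1` for `x ≤ c − d/2`. [folklore] -/
theorem sharpMultipliers_χ₁_eq_one (hd : 0 < d) (h : x ≤ c - d / 2) :
    (sharpMultipliers c L d A).χ₁ x = 1 := by
  show 1 - Real.smoothTransition ((x - c) / d + 1 / 2) = 1
  have h1 := sharpMultipliers_χ₂_eq_zero (c := c) (L := L) (A := A) hd h
  change Real.smoothTransition ((x - c) / d + 1 / 2) = 0 at h1
  rw [h1, sub_zero]

/-- `χ₂' = 0` (hence `χ₁' = 0`) for `|x − c| ≥ d/2`. [folklore] -/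
theorem sharpMultipliers_χ₂'_eq_zero (hd : 0 < d) (h : d / 2 ≤ |x - c|) :
    (sharpMultipliers c L d A).χ₂' x = 0 := by
  show deriv Real.smoothTransition ((x - c) / d + 1 / 2) / d = 0
  rcases le_abs'.1 h with h1 | h1
  · rw [deriv_smoothTransition_of_nonpos, zero_div]
    have : (x - c) / d ≤ -(1 / 2) := by rw [div_le_iff₀ hd]; linarith
    linarith
  · rw [deriv_smoothTransition_of_one_le, zero_div]
    have : 1 / 2 ≤ (x - c) / d := by rw [le_div_iff₀ hd]; linarith
    linarith

/-- `|χ₂'| ≤ D_S/d` for a bound `D_S` of `|S'|`. [folklore] -/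
theorem sharpMultipliers_abs_χ₂'_le (hd : 0 < d)
    (hD : ∀ t, |deriv Real.smoothTransition t| ≤ D) (x : ℝ) :
    |(sharpMultipliers c L d A).χ₂' x| ≤ D / d := by
  show |deriv Real.smoothTransition ((x - c) / d + 1 / 2) / d| ≤ D / d
  rw [abs_div, abs_of_pos hd]
  exact div_le_div_of_nonneg_right (hD _) hd.le

/-- `y = 0`. [folklore] -/
theorem sharpMultipliers_y (c L d A : ℝ) : (sharpMultipliers c L d A).y = 0 := rfl

/-- `y' = 0`. [folklore] -/
theorem sharpMultipliers_y' (c L d A : ℝ) : (sharpMultipliers c L d A).y' = 0 := rfl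

/-! #### End limits -/

/-- **End limits at `r* = +∞`**: `f → 1`, `y → 0`, `χ₁ → 0`, `χ₂ → 1` (and `f', f'', h, h' → 0`),
all profiles being eventually constant — the conditions "`f = 1`, `h = 0`, `χ₁ = 0`, `χ₂ = 1` for
`r ≥ R_∞`" of DRSR arXiv:1402.7034, Prop. 8.3.1. [cite: DafermosRodnianskiShlapentokhrothman2014, Prop. 8.3.1] -/
theorem endLimits_sharpMultipliers_atTop (hL : 0 < L) (hd : 0 < d) (c A : ℝ) :
    (sharpMultipliers c L d A).EndLimits atTop 1 0 0 1 where
  tendsto_f := by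
    apply tendsto_const_nhds.congr'
    filter_upwards [eventually_ge_atTop (c + 2 * L)] with x hx
    exact (sharpMultipliers_f_eq_one hL hx).symm
  tendsto_f' := ⟨0, by
    apply tendsto_const_nhds.congr'
    filter_upwards [eventually_ge_atTop (c + 2 * L)] with x hx
    exact (sharpMultipliers_f'_eq_zero hL (by rw [abs_of_nonneg (by linarith)]; linarith)).symm⟩
  tendsto_f'' := by
    apply tendsto_const_nhds.congr'
    filter_upwards [eventually_ge_atTop (c + 2 * L)] with x hx
    exact (sharpMultipliers_f''_eq_zero hL (by rw [abs_of_nonneg (by linarith)]; linarith)).symm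
  tendsto_h := ⟨0, by
    apply tendsto_const_nhds.congr'
    filter_upwards [eventually_ge_atTop (c + 2 * d)] with x hx
    exact (sharpMultipliers_h_eq_zero hd (by rw [abs_of_nonneg (by linarith)]; linarith)).symm⟩
  tendsto_h' := by
    apply tendsto_const_nhds.congr'
    filter_upwards [eventually_ge_atTop (c + 2 * d)] with x hx
    exact (sharpMultipliers_h'_eq_zero hd (by rw [abs_of_nonneg (by linarith)]; linarith)).symm
  tendsto_y := tendsto_const_nhds
  tendsto_χ₁ := by
    apply tendsto_const_nhds.congr'
    filter_upwards [eventually_ge_atTop (c + d / 2)] with x hx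
    exact (sharpMultipliers_χ₁_eq_zero hd hx).symm
  tendsto_χ₂ := by
    apply tendsto_const_nhds.congr'
    filter_upwards [eventually_ge_atTop (c + d / 2)] with x hx
    exact (sharpMultipliers_χ₂_eq_one hd hx).symm

/-- **End limits at the horizon end `r* = −∞`**: `f → −1`, `y → 0`, `χ₁ → 1`, `χ₂ → 0` (and
`f', f'', h, h' → 0`) — "`f = −1` at `r = r₊`", "`χ₁ = 1` for `r ∈ [r₊, r_max − δ/2]`" of DRSR
arXiv:1402.7034, proof of Prop. 8.3.1. [cite: DafermosRodnianskiShlapentokhrothman2014, Prop. 8.3.1 (proof)] -/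
theorem endLimits_sharpMultipliers_atBot (hL : 0 < L) (hd : 0 < d) (c A : ℝ) :
    (sharpMultipliers c L d A).EndLimits atBot (-1) 0 1 0 where
  tendsto_f := by
    apply tendsto_const_nhds.congr'
    filter_upwards [eventually_le_atBot (c - 2 * L)] with x hx
    exact (sharpMultipliers_f_eq_neg_one hL hx).symm
  tendsto_f' := ⟨0, by
    apply tendsto_const_nhds.congr'
    filter_upwards [eventually_le_atBot (c - 2 * L)] with x hx
    exact (sharpMultipliers_f'_eq_zero hL (by rw [abs_of_nonpos (by linarith)]; linarith)).symm⟩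
  tendsto_f'' := by
    apply tendsto_const_nhds.congr'
    filter_upwards [eventually_le_atBot (c - 2 * L)] with x hx
    exact (sharpMultipliers_f''_eq_zero hL (by rw [abs_of_nonpos (by linarith)]; linarith)).symm
  tendsto_h := ⟨0, by
    apply tendsto_const_nhds.congr'
    filter_upwards [eventually_le_atBot (c - 2 * d)] with x hx
    exact (sharpMultipliers_h_eq_zero hd (by rw [abs_of_nonpos (by linarith)]; linarith)).symm⟩
  tendsto_h' := by
    apply tendsto_const_nhds.congr'
    filter_upwards [eventually_le_atBot (c - 2 * d)] with x hx
    exact (sharpMultipliers_h'_eq_zero hd (by rw [abs_of_nonpos (by linarith)]; linarith)).symm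
  tendsto_y := tendsto_const_nhds
  tendsto_χ₁ := by
    apply tendsto_const_nhds.congr'
    filter_upwards [eventually_le_atBot (c - d / 2)] with x hx
    exact (sharpMultipliers_χ₁_eq_one hd hx).symm
  tendsto_χ₂ := by
    apply tendsto_const_nhds.congr'
    filter_upwards [eventually_le_atBot (c - d / 2)] with x hx
    exact (sharpMultipliers_χ₂_eq_zero hd hx).symm

/-! #### Continuity (for the integrability of the source term) -/

/-- `f` is continuous. [folklore] -/
theorem continuous_sharpMultipliers_f (c L d A : ℝ) : Continuous (sharpMultipliers c L d A).f :=
  continuous_iff_continuousAt.2 fun x ↦ ((hasDerivs_sharpMultipliers c L d A).df x).continuousAt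

/-- `f'` is continuous. [folklore] -/
theorem continuous_sharpMultipliers_f' (c L d A : ℝ) : Continuous (sharpMultipliers c L d A).f' :=
  continuous_iff_continuousAt.2 fun x ↦ ((hasDerivs_sharpMultipliers c L d A).df' x).continuousAt

/-- `h` is continuous. [folklore] -/
theorem continuous_sharpMultipliers_h (c L d A : ℝ) : Continuous (sharpMultipliers c L d A).h :=
  continuous_iff_continuousAt.2 fun x ↦ ((hasDerivs_sharpMultipliers c L d A).dh x).continuousAt

/-- `χ₁` is continuous. [folklore] -/
theorem continuous_sharpMultipliers_χ₁ (c L d A : ℝ) : Continuous (sharpMultipliers c L d A).χ₁ :=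
  continuous_iff_continuousAt.2 fun x ↦ ((hasDerivs_sharpMultipliers c L d A).dχ₁ x).continuousAt

/-- `χ₂` is continuous. [folklore] -/
theorem continuous_sharpMultipliers_χ₂ (c L d A : ℝ) : Continuous (sharpMultipliers c L d A).χ₂ :=
  continuous_iff_continuousAt.2 fun x ↦ ((hasDerivs_sharpMultipliers c L d A).dχ₂ x).continuousAt

end Profiles

end Kerr

end Literature.Geometry.Lorentzian

end
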